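import Literature.Topology.FourManifolds.BranchedDoubleCoverUnknot
import Literature.Geometry.Riemannian.SphereGeodesics
import Literature.Geometry.Riemannian.ChangGurskyYangProofs
import HarnessLib

/-!
# The standard example is not charged: the round `S⁴` is a half-turn-invariant metric of
# positive scalar curvature

Topic `Literature/Topology/FourManifolds`; a complement to `BranchedDoubleCoverUnknot.lean`
(`isBranchedDoubleCover_sphere_unknotTwo`: `S⁴` with its linear half-turn `halfTurn` is the
branched double cover of itself along the unknotted 2-sphere — the `s = 0` member of Kuhrman's
family `Σ₂(S⁴, ρK(2,3,|6s+1|))`, arXiv:2507.03798, Thm. 1).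

The named fact `Kuhrman2025_thm3_chargedHomotopySphere` (`ChargedHomotopySphere.lean`) asks for
a homotopy 4-sphere with an involution fixing an `S²` and preserving NO Riemannian metric of
positive scalar curvature. This file proves, in the tree's own vocabulary
(`PseudoRiemannianMetric`, `HasLeviCivita`, `scalarCurvature`, `pullbackBilin`), that the
standard pair `(S⁴, halfTurn)` FAILS the last clause — consistent with Miyazawa's
`|deg(U)| = 1` for the unknot (arXiv:2312.02041, Prop. 3.14) and showing that the curvature
clause of the fact is contentful (not dischargeable by the linear example):

* `halfTurnIso` — the half-turn `(x₀, x₁, x₂, x₃, x₄) ↦ (x₀, x₁, x₂, -x₃, -x₄)` as a linear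
  isometry of `ℝ⁵`, with `sphereMap halfTurnIso = halfTurn`;
* `pullbackBilin_halfTurn_roundMetric` — **the half-turn is an isometry of the round metric**
  (`halfTurn^* g_round = g_round`; Lee 2018, Problem 5-11: restrictions of `O(5)` are
  isometries of the round sphere; the tree's `mvfderiv_coe_sphereMap`);
* `exists_halfTurn_invariant_psc` — the round metric of `S⁴` is a `halfTurn`-invariant
  Riemannian metric with Levi-Civita connection and positive scalar curvature (`= 12`,
  `scalarCurvature_roundMetric_pos`, Lee 2018, Prop. 8.36);
* `not_charged_halfTurn` — hence the curvature clause of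
  `Kuhrman2025_thm3_chargedHomotopySphere` fails for `(S⁴, halfTurn)`.

Everything is a theorem (plus the two auxiliary bundlings `halfTurnLinear`, `halfTurnIso`);
no named facts.

## References

* J. M. Lee, *Introduction to Riemannian Manifolds*, 2nd ed. (2018), Problem 5-11, Prop. 8.36.
  [Lee2018]
* J. Miyazawa, arXiv:2312.02041 (2023), Prop. 3.14. [Miyazawa2023]
* J. Kuhrman, arXiv:2507.03798 (2025), Thm. 1 and Thm. 3. [Kuhrman2025]
-/

open scoped Manifold ContDiff Topology InnerProductSpace
open Function Set Module

noncomputable section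

namespace Literature.Topology.FourManifolds

open GluckUnknot Literature.Geometry.Riemannian Literature.Geometry.Lorentzian
  Literature.Geometry.Lorentzian.PseudoRiemannianMetric

namespace BranchedUnknot

/-- `finrank ℝ ℝ⁵ = 4 + 1` (spelling `Fin 5`), for the sphere API. [folklore] -/
private theorem fact_finrank_five' : Fact (finrank ℝ (EuclideanSpace ℝ (Fin 5)) = 4 + 1) :=
  ⟨finrank_euclideanSpace_fin⟩

attribute [local instance] fact_finrank_five'

/-- The half-turn of `ℝ⁵` is additive. [folklore] -/
theorem halfTurnVec_add (z z' : EuclideanSpace ℝ (Fin 5)) :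
    halfTurnVec (z + z') = halfTurnVec z + halfTurnVec z' := by
  ext i
  fin_cases i <;> simp [halfTurnVec, appendFive, headThree, tailTwo] <;> ring

/-- The half-turn of `ℝ⁵` as a linear map. [folklore] -/
def halfTurnLinear : EuclideanSpace ℝ (Fin 5) →ₗ[ℝ] EuclideanSpace ℝ (Fin 5) where
  toFun := halfTurnVec
  map_add' := halfTurnVec_add
  map_smul' a z := halfTurnVec_smul a z

/-- **The half-turn of `ℝ⁵` as a linear isometry** (an element of `O(5)`: an involutive linear
map preserving norms, `norm_halfTurnVec`). [folklore] -/
def halfTurnIso : EuclideanSpace ℝ (Fin 5) ≃ₗᵢ[ℝ] EuclideanSpace ℝ (Fin 5) :=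
  { LinearEquiv.ofInvolutive halfTurnLinear halfTurnVec_halfTurnVec with
    norm_map' := norm_halfTurnVec }

/-- `halfTurnIso z = halfTurnVec z`. [folklore] -/
@[simp] theorem halfTurnIso_apply (z : EuclideanSpace ℝ (Fin 5)) : halfTurnIso z = halfTurnVec z :=
  rfl

/-- The half-turn of `S⁴` is the sphere map of the linear isometry `halfTurnIso`. [folklore] -/
theorem sphereMap_halfTurnIso : sphereMap halfTurnIso = halfTurn :=
  funext fun _ ↦ Subtype.ext rfl

/-- **The half-turn is an isometry of the round metric of `S⁴`**: `halfTurn^* g_round = g_round`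
(`g_round(v, w) = ⟪dι v, dι w⟫`, `dι ∘ d(halfTurn) = halfTurnIso ∘ dι`, and `halfTurnIso`
preserves inner products; Lee 2018, Problem 5-11). [cite: Lee2018, Problem 5-11] -/
theorem pullbackBilin_halfTurn_roundMetric (y : Metric.sphere (0 : EuclideanSpace ℝ (Fin 5)) 1) :
    pullbackBilin (I := 𝓡 4) (I' := 𝓡 4) halfTurn
        (roundMetric (n := 4) (EuclideanSpace ℝ (Fin 5))).val y =
      (roundMetric (n := 4) (EuclideanSpace ℝ (Fin 5))).val y := by
  ext v w
  rw [pullbackBilin_apply, ← sphereMap_halfTurnIso, roundMetric_val_eq_inner,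
    roundMetric_val_eq_inner, mvfderiv_coe_sphereMap, mvfderiv_coe_sphereMap,
    LinearIsometryEquiv.inner_map_map]

/-- **The round metric of `S⁴` is a half-turn-invariant metric of positive scalar curvature**
with Levi-Civita connection (scalar curvature `4 · 3 = 12 > 0`, Lee 2018, Prop. 8.36; invariance
by `pullbackBilin_halfTurn_roundMetric`). [cite: Lee2018, Prop. 8.36] -/
theorem exists_halfTurn_invariant_psc :
    ∃ (g : PseudoRiemannianMetric (𝓡 4) ∞ (EuclideanSpace ℝ (Fin 4))
        (TangentSpace (𝓡 4) : Metric.sphere (0 : EuclideanSpace ℝ (Fin 5)) 1 → Type _))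
      (_ : g.HasLeviCivita),
      g.IsRiemannian ∧ (∀ x, 0 < g.scalarCurvature x) ∧
        ∀ y, pullbackBilin (I := 𝓡 4) (I' := 𝓡 4) halfTurn g.val y = g.val y := by
  haveI : (roundMetric (n := 4) (EuclideanSpace ℝ (Fin 5))).HasLeviCivita :=
    (roundMetric (n := 4) (EuclideanSpace ℝ (Fin 5))).hasLeviCivita
  exact ⟨roundMetric (n := 4) (EuclideanSpace ℝ (Fin 5)), ‹_›, isRiemannian_roundMetric,
    fun x ↦ scalarCurvature_roundMetric_pos _ (by norm_num) x, pullbackBilin_halfTurn_roundMetric⟩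

/-- **The standard example is not charged.** The curvature clause of
`Kuhrman2025_thm3_chargedHomotopySphere` — "no `ι`-invariant Riemannian metric with Levi-Civita
connection has positive scalar curvature" — FAILS for `(S⁴, halfTurn)`, the `s = 0` member of
Kuhrman's family (consistent with `|deg(U)| = 1` for the unknot, Miyazawa 2023, Prop. 3.14): the
round metric is such a metric. [cite: Miyazawa2023, Prop. 3.14] -/
theorem not_charged_halfTurn :
    ¬ ∀ (g : PseudoRiemannianMetric (𝓡 4) ∞ (EuclideanSpace ℝ (Fin 4))
        (TangentSpace (𝓡 4) : Metric.sphere (0 : EuclideanSpace ℝ (Fin 5)) 1 → Type _))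
        (_ : g.HasLeviCivita),
        g.IsRiemannian → (∀ x, 0 < g.scalarCurvature x) →
          ¬ ∀ y, pullbackBilin (I := 𝓡 4) (I' := 𝓡 4) halfTurn g.val y = g.val y := by
  intro h
  obtain ⟨g, hLC, hR, hS, hinv⟩ := exists_halfTurn_invariant_psc
  exact h g hLC hR hS hinv

end BranchedUnknot

end Literature.Topology.FourManifolds
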